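import Literature.MathematicalPhysics.QuantumFieldTheory.PinnedOneLinkLaplaceDoubling
import Mathlib.MeasureTheory.Integral.Layercake
import HarnessLib

/-!
# Laplace-type integral bounds on a compact matrix group from volume doubling

Fifth file of the proof of the named fact
`Literature.MathematicalPhysics.QuantumFieldTheory.OneLinkLaplaceConcentration`
(`PinnedOneLinkLaplace.lean`). Let `σ` be the Haar probability measure of a compact group `G` with a
continuous unitary matrix representation `ρ`, `d(g) = ‖ρ g - ρ g₀‖_F` the Hilbert–Schmidt distance
to a fixed `g₀`, and `Z(c) = ∫ e^{-c d²} dσ`. From the volume doubling of Hilbert–Schmidt balls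
(`PinnedOneLinkLaplaceDoubling.haar_frobBall_two_mul_le`, constant `D = 5^{2N²}`) we derive, with
no chart and no asymptotics:

* `integral_exp_neg_quarter_le` — **doubling of the Gaussian transforms**: `Z(c/4) ≤ D Z(c)`
  (layer-cake formula: the super-level sets `{e^{-c d²/4} ≥ t}`, `{e^{-c d²} ≥ t}` are the balls of
  radii `2R_t`, `R_t`, `R_t = (log(1/t)/c)^{1/2}`), and its iterate `integral_exp_neg_le_pow_mul`;
* `integral_sq_mul_exp_le` — **convexity in the inverse temperature**:
  `(3c/4) ∫ d² e^{-c d²} ≤ Z(c/4)` (tangent line of `e^x` at `-c d²`);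
* `integral_sq_mul_exp_neg_le_of_two_sided` — for an exponent with two-sided quadratic bounds
  `a d² ≤ F ≤ 2 d²` (`a > 0`, `4^k a ≥ 2`): `∫ d² e^{-s F} dσ ≤ (4 D^{k+1}/(3 a s)) ∫ e^{-s F} dσ`,
  i.e. the mean of `d²` under `e^{-sF} σ / Z` is `O(1/s)` uniformly — the second-moment form of the
  Laplace method (Breitung, LNM 1592, Ch. 5) that `OneLinkLaplaceConcentration` asserts.

Everything is proved; no definitions.
-/

noncomputable section

open MeasureTheory Set
open scoped ENNReal

namespace Literature.MathematicalPhysics.QuantumFieldTheory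

variable {G : Type*} [Group G] [TopologicalSpace G] [IsTopologicalGroup G] [CompactSpace G]
  [MeasurableSpace G] [BorelSpace G] {N : ℕ}

omit [IsTopologicalGroup G] [CompactSpace G] [MeasurableSpace G] [BorelSpace G] in
/-- `g ↦ ‖ρ g - ρ g₀‖_F` is continuous for a continuous representation. [folklore] -/
theorem continuous_frobDist (ρ : G →* Matrix (Fin N) (Fin N) ℂ) (hρ : Continuous ρ) (g₀ : G) :
    Continuous fun g => frobNorm (ρ g - ρ g₀) :=
  continuous_frobNorm'.comp (hρ.sub continuous_const)

/-- Bounded continuous real functions are integrable for the Haar probability measure. [folklore] -/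
theorem integrable_of_continuous_of_abs_le {f : G → ℝ} (hf : Continuous f) (C : ℝ)
    (hC : ∀ g, |f g| ≤ C) : Integrable f (haarProbability G) :=
  integrable_of_measurable_of_abs_le hf.measurable hC

/-- **Comparison of super-level sets.** For `d ≥ 0` continuous and `c > 0`, every `t`:
`σ{t ≤ e^{-(c/4) d²}} ≤ 5^{2N²} σ{t ≤ e^{-c d²}}`, the sets being Hilbert–Schmidt balls of radii
`2R_t ≥ R_t` (`0 < t ≤ 1`), everything (`t ≤ 0`) or nothing (`t > 1`). [folklore] -/
theorem measure_le_exp_quarter_le (ρ : G →* Matrix (Fin N) (Fin N) ℂ) (hρ : Continuous ρ)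
    (hρu : ∀ g, ρ g ∈ Matrix.unitaryGroup (Fin N) ℂ) (g₀ : G) {c : ℝ} (hc : 0 < c) (t : ℝ) :
    haarProbability G {g | t ≤ Real.exp (-(c / 4) * frobNorm (ρ g - ρ g₀) ^ 2)} ≤
      5 ^ (2 * N ^ 2) * haarProbability G {g | t ≤ Real.exp (-c * frobNorm (ρ g - ρ g₀) ^ 2)} := by
  set μ := haarProbability G
  have hD1 : (1 : ℝ≥0∞) ≤ 5 ^ (2 * N ^ 2) := one_le_pow_of_one_le' (by norm_num) _
  rcases le_or_gt t 0 with ht | ht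
  · -- `t ≤ 0`: the right-hand set is everything
    have h2 : {g | t ≤ Real.exp (-c * frobNorm (ρ g - ρ g₀) ^ 2)} = univ :=
      eq_univ_of_forall fun g => ht.trans (Real.exp_pos _).le
    rw [h2]
    exact (measure_mono (subset_univ _)).trans (le_mul_of_one_le_left zero_le hD1)
  rcases le_or_gt t 1 with ht1 | ht1
  · -- `0 < t ≤ 1`: balls of radii `2R` and `R`
    set R : ℝ := Real.sqrt (-Real.log t / c) with hR
    have hlog : 0 ≤ -Real.log t := neg_nonneg.2 (Real.log_nonpos ht.le ht1)
    have hR0 : 0 ≤ R := Real.sqrt_nonneg _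
    have hR2 : R ^ 2 = -Real.log t / c := Real.sq_sqrt (div_nonneg hlog hc.le)
    have incl₁ : {g | t ≤ Real.exp (-(c / 4) * frobNorm (ρ g - ρ g₀) ^ 2)} ⊆
        {g | frobNorm (ρ g - ρ g₀) ≤ 2 * R} := by
      intro g hg
      have h1 : Real.log t ≤ -(c / 4) * frobNorm (ρ g - ρ g₀) ^ 2 := (Real.log_le_iff_le_exp ht).2 hg
      have h2 : frobNorm (ρ g - ρ g₀) ^ 2 ≤ (2 * R) ^ 2 := by
        rw [mul_pow, hR2, ← mul_div_assoc, le_div_iff₀ hc]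
        nlinarith
      exact (pow_le_pow_iff_left₀ (frobNorm_nonneg _) (by positivity) two_ne_zero).1 h2
    have incl₂ : {g | frobNorm (ρ g - ρ g₀) ≤ R} ⊆
        {g | t ≤ Real.exp (-c * frobNorm (ρ g - ρ g₀) ^ 2)} := by
      intro g hg
      have hg' : frobNorm (ρ g - ρ g₀) ≤ R := hg
      have h1 : frobNorm (ρ g - ρ g₀) ^ 2 ≤ R ^ 2 := pow_le_pow_left₀ (frobNorm_nonneg _) hg' 2
      rw [hR2, le_div_iff₀ hc] at h1
      show t ≤ Real.exp (-c * frobNorm (ρ g - ρ g₀) ^ 2)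
      rw [← Real.log_le_iff_le_exp ht]
      nlinarith
    calc μ {g | t ≤ Real.exp (-(c / 4) * frobNorm (ρ g - ρ g₀) ^ 2)}
        ≤ μ {g | frobNorm (ρ g - ρ g₀) ≤ 2 * R} := measure_mono incl₁
      _ ≤ 5 ^ (2 * N ^ 2) * μ {g | frobNorm (ρ g - ρ g₀) ≤ R} :=
          haar_frobBall_two_mul_le ρ hρ hρu g₀ hR0
      _ ≤ 5 ^ (2 * N ^ 2) * μ {g | t ≤ Real.exp (-c * frobNorm (ρ g - ρ g₀) ^ 2)} :=
          mul_le_mul_of_nonneg_left (measure_mono incl₂) zero_le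
  · -- `t > 1`: the left-hand set is empty
    have h1 : {g | t ≤ Real.exp (-(c / 4) * frobNorm (ρ g - ρ g₀) ^ 2)} = ∅ := by
      refine eq_empty_of_forall_notMem fun g hg => ?_
      have : Real.exp (-(c / 4) * frobNorm (ρ g - ρ g₀) ^ 2) ≤ 1 := by
        rw [Real.exp_le_one_iff]
        nlinarith [sq_nonneg (frobNorm (ρ g - ρ g₀))]
      exact absurd (hg.trans this) (not_le.2 ht1)
    rw [h1, measure_empty]
    exact zero_le

/-- **Doubling of the Gaussian transforms**: `∫ e^{-(c/4) d²} dσ ≤ 5^{2N²} ∫ e^{-c d²} dσ` for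
`d = ‖ρ · - ρ g₀‖_F`, `c > 0` (layer-cake formula and `measure_le_exp_quarter_le`). [folklore] -/
theorem integral_exp_neg_quarter_le (ρ : G →* Matrix (Fin N) (Fin N) ℂ) (hρ : Continuous ρ)
    (hρu : ∀ g, ρ g ∈ Matrix.unitaryGroup (Fin N) ℂ) (g₀ : G) {c : ℝ} (hc : 0 < c) :
    ∫ g, Real.exp (-(c / 4) * frobNorm (ρ g - ρ g₀) ^ 2) ∂(haarProbability G) ≤
      5 ^ (2 * N ^ 2) * ∫ g, Real.exp (-c * frobNorm (ρ g - ρ g₀) ^ 2) ∂(haarProbability G) := by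
  set μ := haarProbability G
  have hd := continuous_frobDist ρ hρ g₀
  set f₁ : G → ℝ := fun g => Real.exp (-(c / 4) * frobNorm (ρ g - ρ g₀) ^ 2) with hf₁
  set f₂ : G → ℝ := fun g => Real.exp (-c * frobNorm (ρ g - ρ g₀) ^ 2) with hf₂
  have hf₁c : Continuous f₁ := Real.continuous_exp.comp (continuous_const.mul (hd.pow 2))
  have hf₂c : Continuous f₂ := Real.continuous_exp.comp (continuous_const.mul (hd.pow 2))
  have hf₁i : Integrable f₁ μ := integrable_of_continuous_of_abs_le hf₁c 1 fun g => by
    rw [abs_of_pos (Real.exp_pos _), Real.exp_le_one_iff]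
    nlinarith [sq_nonneg (frobNorm (ρ g - ρ g₀))]
  have hf₂i : Integrable f₂ μ := integrable_of_continuous_of_abs_le hf₂c 1 fun g => by
    rw [abs_of_pos (Real.exp_pos _), Real.exp_le_one_iff]
    nlinarith [sq_nonneg (frobNorm (ρ g - ρ g₀))]
  have H : ∫⁻ g, ENNReal.ofReal (f₁ g) ∂μ ≤ 5 ^ (2 * N ^ 2) * ∫⁻ g, ENNReal.ofReal (f₂ g) ∂μ := by
    rw [lintegral_eq_lintegral_meas_le μ (ae_of_all _ fun g => (Real.exp_pos _).le)
        hf₁c.measurable.aemeasurable,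
      lintegral_eq_lintegral_meas_le μ (ae_of_all _ fun g => (Real.exp_pos _).le)
        hf₂c.measurable.aemeasurable,
      ← lintegral_const_mul' _ _ (by simp)]
    exact lintegral_mono fun t => measure_le_exp_quarter_le ρ hρ hρu g₀ hc t
  have h1 : ENNReal.ofReal (∫ g, f₁ g ∂μ) ≤ ENNReal.ofReal (5 ^ (2 * N ^ 2) * ∫ g, f₂ g ∂μ) := by
    rw [ofReal_integral_eq_lintegral_ofReal hf₁i (ae_of_all _ fun g => (Real.exp_pos _).le),
      ENNReal.ofReal_mul (by positivity), ENNReal.ofReal_pow (by norm_num), ENNReal.ofReal_ofNat,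
      ofReal_integral_eq_lintegral_ofReal hf₂i (ae_of_all _ fun g => (Real.exp_pos _).le)]
    exact H
  exact (ENNReal.ofReal_le_ofReal_iff (mul_nonneg (by positivity)
    (integral_nonneg fun g => (Real.exp_pos _).le))).1 h1

/-- **Iterated doubling of the Gaussian transforms**:
`∫ e^{-c d²} dσ ≤ (5^{2N²})^k ∫ e^{-4^k c d²} dσ`. [folklore] -/
theorem integral_exp_neg_le_pow_mul (ρ : G →* Matrix (Fin N) (Fin N) ℂ) (hρ : Continuous ρ)
    (hρu : ∀ g, ρ g ∈ Matrix.unitaryGroup (Fin N) ℂ) (g₀ : G) {c : ℝ} (hc : 0 < c) (k : ℕ) :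
    ∫ g, Real.exp (-c * frobNorm (ρ g - ρ g₀) ^ 2) ∂(haarProbability G) ≤
      (5 ^ (2 * N ^ 2)) ^ k *
        ∫ g, Real.exp (-(4 ^ k * c) * frobNorm (ρ g - ρ g₀) ^ 2) ∂(haarProbability G) := by
  induction k with
  | zero => simp
  | succ k ih =>
    have h := integral_exp_neg_quarter_le ρ hρ hρu g₀ (c := 4 ^ (k + 1) * c) (by positivity)
    have heq : (fun g => Real.exp (-(4 ^ (k + 1) * c / 4) * frobNorm (ρ g - ρ g₀) ^ 2)) =
        fun g => Real.exp (-(4 ^ k * c) * frobNorm (ρ g - ρ g₀) ^ 2) := by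
      funext g; congr 1; rw [pow_succ]; ring
    rw [heq] at h
    calc ∫ g, Real.exp (-c * frobNorm (ρ g - ρ g₀) ^ 2) ∂(haarProbability G)
        ≤ (5 ^ (2 * N ^ 2)) ^ k *
          ∫ g, Real.exp (-(4 ^ k * c) * frobNorm (ρ g - ρ g₀) ^ 2) ∂(haarProbability G) := ih
      _ ≤ (5 ^ (2 * N ^ 2)) ^ k * (5 ^ (2 * N ^ 2) *
          ∫ g, Real.exp (-(4 ^ (k + 1) * c) * frobNorm (ρ g - ρ g₀) ^ 2) ∂(haarProbability G)) :=
          mul_le_mul_of_nonneg_left h (by positivity)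
      _ = (5 ^ (2 * N ^ 2)) ^ (k + 1) *
          ∫ g, Real.exp (-(4 ^ (k + 1) * c) * frobNorm (ρ g - ρ g₀) ^ 2) ∂(haarProbability G) := by
          rw [pow_succ]; ring

/-- The tangent-line inequality behind the convexity bound: `(3/4) c y e^{-c y} ≤ e^{-(c/4) y}`.
[folklore] -/
theorem mul_exp_neg_le_exp_neg_quarter (c y : ℝ) :
    (3 / 4) * c * y * Real.exp (-c * y) ≤ Real.exp (-(c / 4) * y) := by
  have h1 : 1 + (3 / 4) * c * y ≤ Real.exp ((3 / 4) * c * y) := by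
    have := Real.add_one_le_exp ((3 / 4) * c * y); linarith
  have h2 : Real.exp (-(c / 4) * y) = Real.exp (-c * y) * Real.exp ((3 / 4) * c * y) := by
    rw [← Real.exp_add]; congr 1; ring
  rw [h2]
  have h3 : (3 / 4) * c * y * Real.exp (-c * y) ≤ (1 + (3 / 4) * c * y) * Real.exp (-c * y) := by
    nlinarith [Real.exp_pos (-c * y)]
  calc (3 / 4) * c * y * Real.exp (-c * y) ≤ (1 + (3 / 4) * c * y) * Real.exp (-c * y) := h3
    _ = Real.exp (-c * y) * (1 + (3 / 4) * c * y) := by ring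
    _ ≤ Real.exp (-c * y) * Real.exp ((3 / 4) * c * y) :=
        mul_le_mul_of_nonneg_left h1 (Real.exp_pos _).le

/-- **Convexity in the inverse temperature**: `(3c/4) ∫ d² e^{-c d²} dσ ≤ ∫ e^{-(c/4) d²} dσ`.
[folklore] -/
theorem integral_sq_mul_exp_le (ρ : G →* Matrix (Fin N) (Fin N) ℂ) (hρ : Continuous ρ)
    (g₀ : G) {c : ℝ} (hc : 0 < c) :
    (3 / 4) * c * ∫ g, frobNorm (ρ g - ρ g₀) ^ 2 * Real.exp (-c * frobNorm (ρ g - ρ g₀) ^ 2)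
        ∂(haarProbability G) ≤
      ∫ g, Real.exp (-(c / 4) * frobNorm (ρ g - ρ g₀) ^ 2) ∂(haarProbability G) := by
  set μ := haarProbability G
  have hd := continuous_frobDist ρ hρ g₀
  rw [← integral_const_mul]
  refine integral_mono_of_nonneg (ae_of_all _ fun g => ?_) ?_ (ae_of_all _ fun g => ?_)
  · have : 0 ≤ frobNorm (ρ g - ρ g₀) ^ 2 := sq_nonneg _
    positivity
  · refine integrable_of_continuous_of_abs_le
      (Real.continuous_exp.comp (continuous_const.mul (hd.pow 2))) 1 fun g => ?_
    rw [abs_of_pos (Real.exp_pos _), Real.exp_le_one_iff]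
    nlinarith [sq_nonneg (frobNorm (ρ g - ρ g₀))]
  · have := mul_exp_neg_le_exp_neg_quarter c (frobNorm (ρ g - ρ g₀) ^ 2)
    simpa [mul_assoc] using this

/-- **Second-moment Laplace bound from two-sided quadratic bounds.** If `F : G → ℝ` is continuous
with `a d² ≤ F ≤ 2 d²`, `d = ‖ρ · - ρ g₀‖_F`, `a > 0`, `4^k a ≥ 2` and `s > 0`, then
`∫ d² e^{-s F} dσ ≤ (4 (5^{2N²})^{k+1} / (3 a s)) ∫ e^{-s F} dσ`: under `e^{-sF}σ/Z` the mean of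
`d²` is `O(1/s)`, uniformly in `F` (doubling + convexity, no asymptotics). [folklore] -/
theorem integral_sq_mul_exp_neg_le_of_two_sided (ρ : G →* Matrix (Fin N) (Fin N) ℂ)
    (hρ : Continuous ρ) (hρu : ∀ g, ρ g ∈ Matrix.unitaryGroup (Fin N) ℂ) (g₀ : G)
    {F : G → ℝ} (hF : Continuous F) {a s : ℝ} (ha : 0 < a) (hs : 0 < s) {k : ℕ} (hk : 2 ≤ 4 ^ k * a)
    (hlo : ∀ g, a * frobNorm (ρ g - ρ g₀) ^ 2 ≤ F g) (hhi : ∀ g, F g ≤ 2 * frobNorm (ρ g - ρ g₀) ^ 2) :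
    ∫ g, frobNorm (ρ g - ρ g₀) ^ 2 * Real.exp (-s * F g) ∂(haarProbability G) ≤
      4 * (5 ^ (2 * N ^ 2)) ^ (k + 1) / (3 * a * s) *
        ∫ g, Real.exp (-s * F g) ∂(haarProbability G) := by
  set μ := haarProbability G
  set D : ℝ := 5 ^ (2 * N ^ 2) with hD
  have hd := continuous_frobDist ρ hρ g₀
  have hF0 : ∀ g, 0 ≤ F g := fun g => (mul_nonneg ha.le (sq_nonneg _)).trans (hlo g)
  have hd2 : ∀ g, frobNorm (ρ g - ρ g₀) ^ 2 ≤ 4 * N := fun g => by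
    have h := frobNorm_sub_le_of_mem_unitaryGroup (hρu g) (hρu g₀)
    have h' := pow_le_pow_left₀ (frobNorm_nonneg _) h 2
    rw [mul_pow, Real.sq_sqrt (Nat.cast_nonneg _), Fintype.card_fin] at h'
    linarith
  -- Step 1: `e^{-sF} ≤ e^{-s a d²}`
  have h1 : ∫ g, frobNorm (ρ g - ρ g₀) ^ 2 * Real.exp (-s * F g) ∂μ ≤
      ∫ g, frobNorm (ρ g - ρ g₀) ^ 2 * Real.exp (-(s * a) * frobNorm (ρ g - ρ g₀) ^ 2) ∂μ := by
    refine integral_mono_of_nonneg (ae_of_all _ fun g => by positivity) ?_ (ae_of_all _ fun g => ?_)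
    · refine integrable_of_continuous_of_abs_le
        ((hd.pow 2).mul (Real.continuous_exp.comp (continuous_const.mul (hd.pow 2)))) (4 * (N : ℝ))
        fun g => ?_
      rw [abs_of_nonneg (by positivity)]
      have he : Real.exp (-(s * a) * frobNorm (ρ g - ρ g₀) ^ 2) ≤ 1 := by
        rw [Real.exp_le_one_iff]
        have : 0 ≤ (s * a) * frobNorm (ρ g - ρ g₀) ^ 2 := by positivity
        linarith
      calc frobNorm (ρ g - ρ g₀) ^ 2 * Real.exp (-(s * a) * frobNorm (ρ g - ρ g₀) ^ 2)
          ≤ frobNorm (ρ g - ρ g₀) ^ 2 * 1 := mul_le_mul_of_nonneg_left he (sq_nonneg _)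
        _ ≤ 4 * (N : ℝ) := by rw [mul_one]; exact hd2 g
    · refine mul_le_mul_of_nonneg_left (Real.exp_le_exp.2 ?_) (sq_nonneg _)
      nlinarith [hlo g]
  -- Step 2: convexity, doubling, iterated doubling
  have h2 := integral_sq_mul_exp_le ρ hρ g₀ (c := s * a) (by positivity)
  have h3 := integral_exp_neg_quarter_le ρ hρ hρu g₀ (c := s * a) (by positivity)
  have h4 := integral_exp_neg_le_pow_mul ρ hρ hρu g₀ (c := s * a) (by positivity) k
  -- Step 3: `e^{-4^k s a d²} ≤ e^{-sF}`
  have h5 : ∫ g, Real.exp (-(4 ^ k * (s * a)) * frobNorm (ρ g - ρ g₀) ^ 2) ∂μ ≤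
      ∫ g, Real.exp (-s * F g) ∂μ := by
    refine integral_mono_of_nonneg (ae_of_all _ fun g => (Real.exp_pos _).le) ?_
      (ae_of_all _ fun g => ?_)
    · refine integrable_of_continuous_of_abs_le (Real.continuous_exp.comp (continuous_const.mul hF)) 1
        fun g => ?_
      rw [abs_of_pos (Real.exp_pos _), Real.exp_le_one_iff]
      nlinarith [hF0 g]
    · refine Real.exp_le_exp.2 ?_
      have := hhi g
      have h6 : s * F g ≤ s * (4 ^ k * a) * frobNorm (ρ g - ρ g₀) ^ 2 := by
        calc s * F g ≤ s * (2 * frobNorm (ρ g - ρ g₀) ^ 2) := mul_le_mul_of_nonneg_left this hs.le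
          _ ≤ s * (4 ^ k * a * frobNorm (ρ g - ρ g₀) ^ 2) := by
              refine mul_le_mul_of_nonneg_left ?_ hs.le
              exact mul_le_mul_of_nonneg_right hk (sq_nonneg _)
          _ = s * (4 ^ k * a) * frobNorm (ρ g - ρ g₀) ^ 2 := by ring
      nlinarith
  -- combine
  have hI0 : 0 ≤ ∫ g, Real.exp (-s * F g) ∂μ := integral_nonneg fun g => (Real.exp_pos _).le
  have hsa : 0 < s * a := by positivity
  have hkey : (3 / 4) * (s * a) *
      ∫ g, frobNorm (ρ g - ρ g₀) ^ 2 * Real.exp (-(s * a) * frobNorm (ρ g - ρ g₀) ^ 2) ∂μ ≤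
      D ^ (k + 1) * ∫ g, Real.exp (-s * F g) ∂μ := by
    calc _ ≤ ∫ g, Real.exp (-(s * a / 4) * frobNorm (ρ g - ρ g₀) ^ 2) ∂μ := h2
      _ ≤ D * ∫ g, Real.exp (-(s * a) * frobNorm (ρ g - ρ g₀) ^ 2) ∂μ := h3
      _ ≤ D * (D ^ k * ∫ g, Real.exp (-(4 ^ k * (s * a)) * frobNorm (ρ g - ρ g₀) ^ 2) ∂μ) :=
          mul_le_mul_of_nonneg_left h4 (by positivity)
      _ ≤ D * (D ^ k * ∫ g, Real.exp (-s * F g) ∂μ) :=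
          mul_le_mul_of_nonneg_left (mul_le_mul_of_nonneg_left h5 (by positivity)) (by positivity)
      _ = D ^ (k + 1) * ∫ g, Real.exp (-s * F g) ∂μ := by rw [pow_succ]; ring
  have : ∫ g, frobNorm (ρ g - ρ g₀) ^ 2 * Real.exp (-(s * a) * frobNorm (ρ g - ρ g₀) ^ 2) ∂μ ≤
      4 * D ^ (k + 1) / (3 * a * s) * ∫ g, Real.exp (-s * F g) ∂μ := by
    rw [div_mul_eq_mul_div, le_div_iff₀ (by positivity)]
    nlinarith
  exact h1.trans this

end Literature.MathematicalPhysics.QuantumFieldTheory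

end
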